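import Summits.ABC.IUTFork.Repair.RHTameCellWindow
import Summits.ABC.IUTFork.Repair.RHTameBandLicenceSigma
import HarnessLib

/-!
# R-H ROUND 2, SLICE row 5: the band cell is DOWNWARD CLOSED in the label, so `Σ₅ ∩ (place)` is an EXACT initial segment — by theorem

Seat abc-iut-rh-typ-5 (R-H PAIR n = 5 TYPER, gen 4; round-2 row-5 hand). PROOF-ONLY over this seat's `RH.TameBandLicence.Cell` (p458742),
abc-iut-rh-tst-5's sandwich `RHTameCellWindow` (p475488, proxy-filed) and this seat's packet stratum `RH.TameBandLicenceSigma.sigmaFive`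
(p472055). No `def`, no new `Prop`, no instance. HONEST FRAMING: nothing here asserts abc proved or refuted; no side is taken on
[IUTchIII] Cor. 3.12 or on any author; H⋆ rows are hypotheses; typed ≠ proved; computed ≠ proved.

WHAT THIS FILE ADDS TO plan/rescue/R-H/SLICE.md (row 5) and MIN-SLICE.md §(i)/(iv). The sandwich `(j+1)·P ≤ e−1 ⟹ Cell e P j ⟹ (j−1)·P ≤ e−1`
(`cell_sandwich`) locates the place's window `W = {j ≥ 1 : Cell e P j}` between `{1..j₀−1}` and `{1..j₀+1}`, `j₀ := ⌊(e−1)/P⌋`, but does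
not by itself exclude a hole at the two boundary labels (`j₀ ∉ W ∋ j₀+1`); SLICE (S0) «Σ_R ∩ datum IS an initial segment» was so far a TABLE
fact (10,480/10,480 HEX cells; 7,534/7,534 WINDOW-TABLE packets). Here it is a THEOREM for every integer `e ≥ 1`, `j ≥ 1` and every `P`:

* §1 `not_cell_succ_of_not_cell` / `cell_of_cell_succ` / `cell_anti` / `not_cell_mono`: a FAILING label `j` forces `(2j+1)·P ≥ e`
  (else `(j²−1)P ≥ j(e−1)+1 > j(2j+1)P`), hence `⌊((j+1)²P−1)/e⌋ ≥ ⌊(j²P−1)/e⌋ + 1` and label `j+1` fails too — the cell is an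
  initial segment in `j` EXACTLY, on every datum, with no table.
* §2 `cell_iff_le_of_boundary`: ONE certified boundary pair (`Cell e P J`, `¬ Cell e P (J+1)`) pins the whole window `W = {1..J}`;
  `boundary_bracket`: any such `J` satisfies `⌊(e−1)/P⌋ − 1 ≤ J ≤ ⌊(e−1)/P⌋ + 1` (`P ≥ 1`); `exists_boundary`: such a `J ≥ 1` exists
  (`P ≥ 1`). So two cell evaluations per place certify a table's slice column, and the three-valued bracket of abc-iut-rh-tst-5's histogram
  (offsets 0/1/2 from `max(0, j₀−1)`) is the complete list of cases.
* §3 `six_mul_sum_sq_sub_one`: the `j²−1` label mass of an initial segment in closed form, `6·Σ_{j≤n}(j²−1) = n(n−1)(2n+5)`, so the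
  place's trivial-cost share on its slice is `J(J−1)(2J+5) / (l⋆(l⋆−1)(2l⋆+5))` EXACTLY (MIN-SLICE (iii)(A) «mass₄ = frac₄³ ± 4·10⁻³»,
  (iv) «(j₀/l⋆)³»: the cubic law with its lower-order terms).
* §4 `sigmaFive_inr_anti` / `exists_sliceBoundary_sigmaFive`: the same for the stratum OF RECORD `Σ₅` of a MIXED genuine datum
  (`pilotDataOfK D K`): every prime packet column of `Σ₅` is an initial segment of labels `{i : i < J_p}` (empty exactly at the bad primes that
  are not uniformly tame; everything at archimedean and bad-place-free packets).
The lead's SLICE row-5 closed form `j₀ = ⌊((e_w−1)+√((e_w−1)²+4m_q²))/(2m_q)⌋` is the remainder-free (`ρ_j = 0`) end of the bracket; the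
exact clause is `(j²−1)·m_q ≤ j·(e_w−1) + ρ_j`, `ρ_j := (j²m_q − 1) mod e_w ∈ [0, e_w−1]` (`cell_iff`).
[cite: Mochizuki2012, IUTchI Ex. 3.2 (iv) p. 71; IUTchIII Cor. 3.12 Step (xi-f) p. 184; IUTchIV Prop. 1.2 (i)(ii) p. 10]
[claim: Mochizuki2012, status: disputed]. Axioms: standard.
-/

namespace Summit.ABC.IUTFork.Repair.RH.TameBandLicence

/-! ## §1. Downward closure: a failing label propagates upward -/

/-- **If the cell fails at label `j ≥ 1` it fails at `j+1`** (`e ≥ 1`, any `P`). In the exact form `e·⌊(j²P−1)/e⌋ + 1 − j(e−1) ≤ P`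
(`cell_iff_tame_exact`): failure at `j` gives `e·Q_j ≥ P + j(e−1)` with `e·Q_j ≤ j²P − 1`, whence `(2j+1)·P ≥ e` (otherwise
`(j²−1)P ≥ j(e−1) + 1 ≥ j(2j+1)P + 1`, absurd for the then positive `P`), so `Q_{j+1} ≥ Q_j + 1` and
`e·Q_{j+1} + 1 − (j+1)(e−1) ≥ (e·Q_j + 1 − j(e−1)) + 1 > P`. [folklore] -/
theorem not_cell_succ_of_not_cell {e P j : ℤ} (he : 1 ≤ e) (hj : 1 ≤ j) (h : ¬ Cell e P j) : ¬ Cell e P (j + 1) := by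
  rw [cell_iff_tame_exact (by omega)] at h ⊢
  push Not at h ⊢
  have h2 : e * ((j ^ 2 * P - 1) / e) ≤ j ^ 2 * P - 1 := Int.mul_ediv_self_le (by omega)
  -- `P` is positive at a failing label
  have hP : 1 ≤ P := by
    by_contra hP
    push Not at hP
    have h3 : (j ^ 2 - 1) * P ≤ 0 := mul_nonpos_of_nonneg_of_nonpos (by nlinarith) (by omega)
    nlinarith
  -- the key step: `(2j+1)·P ≥ e`
  have h3 : e ≤ (2 * j + 1) * P := by
    by_contra h3
    push Not at h3
    have h4 : j * ((2 * j + 1) * P) ≤ j * (e - 1) := mul_le_mul_of_nonneg_left (by omega) (by omega)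
    nlinarith
  -- hence the floor jumps by at least one
  have h4 : (j ^ 2 * P - 1) / e + 1 ≤ ((j + 1) ^ 2 * P - 1) / e := by
    rw [Int.le_ediv_iff_mul_le (by omega)]
    have h5 : ((j ^ 2 * P - 1) / e + 1) * e = e * ((j ^ 2 * P - 1) / e) + e := by ring
    rw [h5]
    nlinarith
  have h5 : e * ((j ^ 2 * P - 1) / e + 1) ≤ e * (((j + 1) ^ 2 * P - 1) / e) := mul_le_mul_of_nonneg_left h4 (by omega)
  nlinarith

/-- **Downward closure: the cell at `j+1` implies the cell at `j`** (`e ≥ 1`, `j ≥ 1`, any `P`). [folklore] -/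
theorem cell_of_cell_succ {e P j : ℤ} (he : 1 ≤ e) (hj : 1 ≤ j) (h : Cell e P (j + 1)) : Cell e P j := by
  by_contra h'
  exact not_cell_succ_of_not_cell he hj h' h

/-- **The cell is ANTITONE in the label on `j ≥ 1`**: `Cell e P j'` and `1 ≤ j ≤ j'` give `Cell e P j`. [folklore] -/
theorem cell_anti {e P j j' : ℤ} (he : 1 ≤ e) (hj : 1 ≤ j) (hjj : j ≤ j') (h : Cell e P j') : Cell e P j := by
  obtain ⟨n, rfl⟩ : ∃ n : ℕ, j' = j + n := ⟨(j' - j).toNat, by omega⟩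
  induction n with
  | zero => simpa using h
  | succ n ih =>
    refine ih (by omega) (cell_of_cell_succ he (by omega) ?_)
    have h1 : j + ((n : ℤ) + 1) = j + (n : ℤ) + 1 := by ring
    push_cast at h
    rwa [h1] at h

/-- **Failure is MONOTONE in the label**: `¬ Cell e P j` and `1 ≤ j ≤ j'` give `¬ Cell e P j'`. [folklore] -/
theorem not_cell_mono {e P j j' : ℤ} (he : 1 ≤ e) (hj : 1 ≤ j) (hjj : j ≤ j') (h : ¬ Cell e P j) : ¬ Cell e P j' :=
  fun h' => h (cell_anti he hj hjj h')

/-! ## §2. The window is `{1,…,J}` for ONE boundary pair; the boundary lies in the sandwich bracket -/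

/-- **One certified boundary pair pins the whole window**: if `Cell e P J` and `¬ Cell e P (J+1)` (`J ≥ 1`), then for every label `j ≥ 1`,
`Cell e P j ↔ j ≤ J`. [folklore] -/
theorem cell_iff_le_of_boundary {e P J : ℤ} (he : 1 ≤ e) (hJ : 1 ≤ J) (hin : Cell e P J) (hoff : ¬ Cell e P (J + 1))
    {j : ℤ} (hj : 1 ≤ j) : Cell e P j ↔ j ≤ J := by
  constructor
  · intro h
    by_contra hlt
    push Not at hlt
    exact not_cell_mono he (by omega) (by omega) hoff h
  · intro h
    exact cell_anti he hj h hin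

/-- **The boundary is unique.** [folklore] -/
theorem boundary_unique {e P J J' : ℤ} (he : 1 ≤ e) (hJ : 1 ≤ J) (hJ' : 1 ≤ J') (hin : Cell e P J) (hoff : ¬ Cell e P (J + 1))
    (hin' : Cell e P J') (hoff' : ¬ Cell e P (J' + 1)) : J = J' := by
  have h1 : J' ≤ J := (cell_iff_le_of_boundary he hJ hin hoff hJ').1 hin'
  have h2 : J ≤ J' := (cell_iff_le_of_boundary he hJ' hin' hoff' hJ).1 hin
  omega

/-- **BRACKET: any boundary `J` satisfies `⌊(e−1)/P⌋ − 1 ≤ J ≤ ⌊(e−1)/P⌋ + 1`** (`e, P, J ≥ 1`): the upper end is `linear_of_cell`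
(`(J−1)P ≤ e−1`), the lower end is the sufficient half (`(J+2)·P ≤ ⌊(e−1)/P⌋·P ≤ e−1` would put `J+1` IN). [folklore] -/
theorem boundary_bracket {e P J : ℤ} (he : 1 ≤ e) (hP : 1 ≤ P) (hJ : 1 ≤ J) (hin : Cell e P J) (hoff : ¬ Cell e P (J + 1)) :
    (e - 1) / P - 1 ≤ J ∧ J ≤ (e - 1) / P + 1 := by
  have h0 : P * ((e - 1) / P) ≤ e - 1 := Int.mul_ediv_self_le (by omega)
  constructor
  · by_contra hlt
    push Not at hlt
    refine hoff (cell_of_succ_mul_le he (by omega) ?_)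
    have h1 : (J + 1 + 1) * P ≤ ((e - 1) / P) * P := mul_le_mul_of_nonneg_right (by omega) (by omega)
    linarith [mul_comm P ((e - 1) / P)]
  · have h1 : (J - 1) * P ≤ e - 1 := linear_of_cell he hJ hin
    have h2 : J - 1 ≤ (e - 1) / P := (Int.le_ediv_iff_mul_le (by omega)).2 h1
    omega

/-- **EXISTENCE of the boundary** (`e, P ≥ 1`): there is `J ≥ 1` with `Cell e P J`, `¬ Cell e P (J+1)`; it lies in the bracket and the window
is `{1,…,J}`. (Label `1` is always IN — `cell_one_label`; label `⌊(e−1)/P⌋ + 2` is always OFF — `not_cell_of_linear_lt`.) [folklore] -/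
theorem exists_boundary {e P : ℤ} (he : 1 ≤ e) (hP : 1 ≤ P) :
    ∃ J : ℤ, 1 ≤ J ∧ (e - 1) / P - 1 ≤ J ∧ J ≤ (e - 1) / P + 1 ∧ Cell e P J ∧ ¬ Cell e P (J + 1) ∧
      ∀ j : ℤ, 1 ≤ j → (Cell e P j ↔ j ≤ J) := by
  -- it suffices to produce a boundary pair with `J ≥ 1`
  suffices h : ∃ J : ℤ, 1 ≤ J ∧ Cell e P J ∧ ¬ Cell e P (J + 1) by
    obtain ⟨J, hJ, hin, hoff⟩ := h
    exact ⟨J, hJ, (boundary_bracket he hP hJ hin hoff).1, (boundary_bracket he hP hJ hin hoff).2, hin, hoff,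
      fun j hj => cell_iff_le_of_boundary he hJ hin hoff hj⟩
  set j0 : ℤ := (e - 1) / P with hj0
  have hj0nn : 0 ≤ j0 := Int.ediv_nonneg (by omega) (by omega)
  have h0 : P * j0 ≤ e - 1 := Int.mul_ediv_self_le (by omega)
  have h0' : e - 1 < P * j0 + P := Int.lt_mul_ediv_self_add (by omega)
  -- label `j0 + 2` is OFF
  have hoff2 : ¬ Cell e P (j0 + 2) := not_cell_of_linear_lt he (by omega) (by nlinarith)
  have hone : Cell e P 1 := cell_one_label he
  by_cases h1 : Cell e P (j0 + 1)
  · exact ⟨j0 + 1, by omega, h1, by rwa [show j0 + 1 + 1 = j0 + 2 by ring]⟩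
  · -- then `j0 ≥ 1` (label 1 is IN)
    have hj01 : 1 ≤ j0 := by
      by_contra hlt
      have : j0 = 0 := by omega
      rw [this, zero_add] at h1
      exact h1 hone
    by_cases h2 : Cell e P j0
    · exact ⟨j0, hj01, h2, h1⟩
    · -- then `j0 ≥ 2` and `j0 - 1` is IN by the sufficient half
      have hj02 : 2 ≤ j0 := by
        by_contra hlt
        have : j0 = 1 := by omega
        rw [this] at h2
        exact h2 hone
      refine ⟨j0 - 1, by omega, cell_of_succ_mul_le he (by omega) ?_, by rwa [show j0 - 1 + 1 = j0 by ring]⟩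
      have : (j0 - 1 + 1) * P = P * j0 := by ring
      omega

/-! ## §3. The `j² − 1` label mass of an initial segment, in closed form -/

/-- **`6·Σ_{j=1}^{n} (j²−1) = n(n−1)(2n+5)`** (summing `((j+1)²−1)` over `j < n`). With MIN-SLICE's per-place trivial cost
`t_triv(w,j) = c(w)·(j²−1)·m_q(w)` this makes the place's mass share on its slice `{1..J}` equal to `J(J−1)(2J+5) / (l⋆(l⋆−1)(2l⋆+5))`
exactly — the cubic law `(J/l⋆)³` of MIN-SLICE (iv) with its lower-order terms. [folklore] -/
theorem six_mul_sum_sq_sub_one (n : ℕ) :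
    6 * ∑ j ∈ Finset.range n, ((((j : ℕ) : ℤ) + 1) ^ 2 - 1) = (n : ℤ) * ((n : ℤ) - 1) * (2 * (n : ℤ) + 5) := by
  induction n with
  | zero => simp
  | succ n ih =>
    rw [Finset.sum_range_succ, mul_add, ih]
    push_cast
    ring

/-- The same mass is MONOTONE and bounded by the full-label mass: for `J ≤ L`, `J(J−1)(2J+5) ≤ L(L−1)(2L+5)` (`J ≥ 0`). [folklore] -/
theorem sliceMass_mono {J L : ℤ} (hJ : 0 ≤ J) (hJL : J ≤ L) : J * (J - 1) * (2 * J + 5) ≤ L * (L - 1) * (2 * L + 5) := by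
  obtain ⟨n, rfl⟩ : ∃ n : ℕ, L = J + n := ⟨(L - J).toNat, by omega⟩
  have hn : (0 : ℤ) ≤ n := by positivity
  -- `n(n−1) ≥ 0` for a natural number `n` (integrality is used here)
  have hn1 : (0 : ℤ) ≤ (n : ℤ) * ((n : ℤ) - 1) := by
    rcases Nat.eq_zero_or_pos n with h | h
    · simp [h]
    · exact mul_nonneg hn (by omega)
  have key : (J + n) * (J + n - 1) * (2 * (J + n) + 5) - J * (J - 1) * (2 * J + 5) =
      6 * (J * J * n) + 6 * (J * (n * n)) + 6 * (J * n) + (n * (n - 1)) * (2 * n + 5) := by ring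
  nlinarith [key, mul_nonneg (mul_nonneg hJ hJ) hn, mul_nonneg hJ (mul_nonneg hn hn), mul_nonneg hJ hn,
    mul_nonneg hn1 (show (0 : ℤ) ≤ 2 * n + 5 by omega)]

end Summit.ABC.IUTFork.Repair.RH.TameBandLicence

/-! ## §4. The stratum of record `Σ₅` of a mixed genuine datum: every prime packet column is an initial segment of labels -/

noncomputable section
open Set Metric Function NumberField IsDedekindDomain
open scoped Pointwise

namespace Summit.ABC.IUTFork.Repair.RH.TameBandLicenceSigma

open Literature.AnabelianGeometry.AbsoluteAnabelian Literature.IUT.LogThetaLattice Literature.IUT.LogVolume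
  Literature.IUT.HodgeTheaters Literature.NumberTheory.NumberFields Literature.NumberTheory.GaloisRepresentations.Ultrametric
open Summit.ABC.IUTFork.Thm311 Summit.ABC.IUTFork.Thm311.Real Summit.ABC.IUTFork.Cor312 Summit.ABC.IUTFork.Cor312.Setting
  Summit.ABC.IUTFork.Cor312Vol Summit.ABC.IUTFork.Cor312Prov Summit.ABC.IUTFork.Repair.RH.TameBandLicence
  Summit.ABC.IUTFork.Repair.RH.SigmaLicence

variable {F K Fbar : Type} [Field F] [NumberField F] [Field K] [NumberField K] [Algebra F K] [Field Fbar]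
  [Algebra F Fbar] [Algebra K Fbar] {E : WeierstrassCurve F} [E.IsElliptic] {l : ℕ} {Pb : BadPlacePredicates K}
  (D : InitialThetaData F K Fbar E l Pb)

/-- **`Σ₅` is DOWNWARD CLOSED in the label inside every prime packet**: if the packet `(i', p)` is in `Σ₅` and `i ≤ i'` then `(i, p)` is in
`Σ₅` (archimedean packets and bad-place-free prime packets are in `Σ₅` at every label; at a uniformly tame prime the cell at each bad
`w ∣ p` descends by `cell_anti`, `e_w ≥ 1` by `ramificationIdx_placeOf_pos`). [claim: Mochizuki2012, status: disputed] -/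
theorem sigmaFive_inr_anti (pp : Nat.Primes) {i i' : Fin (thetaIndex (pilotDataOfK D K)).lstar} (hii : (i : ℕ) ≤ (i' : ℕ))
    (h : (i', Sum.inr pp) ∈ sigmaFive D) : (i, Sum.inr pp) ∈ sigmaFive D := by
  haveI : Fact (pp : ℕ).Prime := ⟨pp.2⟩
  rw [mem_sigmaFive_inr_iff] at h ⊢
  rcases h with h | ⟨htame, h⟩
  · exact Or.inl h
  · refine Or.inr ⟨htame, fun w hw P hP => ?_⟩
    have hc := h w hw P hP
    have he : (1 : ℤ) ≤ (((placeOf (pilotDataOfK D K) pp.1 w).asIdeal.ramificationIdx ℤ : ℕ) : ℤ) := by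
      have := ramificationIdx_placeOf_pos D pp w
      exact_mod_cast this
    exact cell_anti he (by push_cast; omega) (by push_cast; omega) hc

/-- Archimedean packets are in `Σ₅` at every label. [folklore] -/
theorem mem_sigmaFive_inl (i : Fin (thetaIndex (pilotDataOfK D K)).lstar) (u : Unit) :
    (i, Sum.inl u) ∈ sigmaFive D := by
  show True
  trivial

/-- A downward-closed predicate on `Fin n` is an initial segment `{i : i < J}`. [folklore] -/
private theorem exists_iff_lt_of_downward {n : ℕ} (S : Fin n → Prop)
    (hS : ∀ i i' : Fin n, (i : ℕ) ≤ (i' : ℕ) → S i' → S i) : ∃ J : ℕ, ∀ i : Fin n, S i ↔ (i : ℕ) < J := by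
  classical
  by_cases hne : ∃ i, S i
  · obtain ⟨i₀, hi₀⟩ := hne
    refine ⟨Nat.findGreatest (fun m => ∃ i : Fin n, (i : ℕ) = m ∧ S i) n + 1, fun i => ⟨fun hi => ?_, fun hi => ?_⟩⟩
    · exact Nat.lt_succ_of_le (Nat.le_findGreatest (P := fun m => ∃ i : Fin n, (i : ℕ) = m ∧ S i) i.2.le ⟨i, rfl, hi⟩)
    · obtain ⟨i', hi'eq, hSi'⟩ : ∃ i' : Fin n, (i' : ℕ) = Nat.findGreatest (fun m => ∃ i : Fin n, (i : ℕ) = m ∧ S i) n ∧ S i' :=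
        Nat.findGreatest_spec (P := fun m => ∃ i : Fin n, (i : ℕ) = m ∧ S i) i₀.2.le ⟨i₀, rfl, hi₀⟩
      exact hS i i' (by omega) hSi'
  · exact ⟨0, fun i => ⟨fun hi => (hne ⟨i, hi⟩).elim, fun hi => absurd hi (Nat.not_lt_zero _)⟩⟩

/-- **SLICE (S0) for the stratum of record: every prime packet column of `Σ₅` is an initial segment of labels** — there is `J_p ∈ ℕ`
with `(i, p) ∈ Σ₅ ↔ i < J_p` for all labels `i` (`j = i+1 ≤ J_p`); `J_p = 0` exactly at a bad prime that is not uniformly tame,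
`J_p = l⋆` at bad-place-free primes. [claim: Mochizuki2012, status: disputed] -/
theorem exists_sliceBoundary_sigmaFive (pp : Nat.Primes) :
    ∃ J : ℕ, ∀ i : Fin (thetaIndex (pilotDataOfK D K)).lstar, (i, Sum.inr pp) ∈ sigmaFive D ↔ (i : ℕ) < J :=
  exists_iff_lt_of_downward (fun i => (i, Sum.inr pp) ∈ sigmaFive D) (fun _ _ hii h => sigmaFive_inr_anti D pp hii h)

/-- **Under H⋆₅, at a uniformly tame prime the column is FULL** (`J_p = l⋆`: every label is in `Σ₅`, `mem_sigmaFive_of_hStar`) — the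
round-1 KEEP slice «Σ = everything» of MIN-SLICE (iii) at such packets. [claim: Mochizuki2012, status: disputed] -/
theorem sliceBoundary_full_of_hStar (hH : HStarTameBandLicence D) (pp : Nat.Primes) (htame : UniformlyTameAt D pp)
    (i : Fin (thetaIndex (pilotDataOfK D K)).lstar) : (i, Sum.inr pp) ∈ sigmaFive D :=
  mem_sigmaFive_of_hStar D hH i pp htame

end Summit.ABC.IUTFork.Repair.RH.TameBandLicenceSigma

end

/-! ## §5 (v2). The lead's SLICE closed form is a MINORANT within one label; the top-label mass quantum

SLICE.md v0.5 row 5 prints `j₀ = ⌊((e_w−1)+√((e_w−1)²+4m_q²))/(2m_q)⌋` = the largest label with the band-top inequality `(j²−1)·P ≤ j·(e−1)`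
(remainder `ρ_j = 0`). That label is IN (`cell_of_bandTop`), so `j₀ ≤ J`; and `J ≤ j₀ + 1` because the failure of the band-top inequality at a
label `j` already forces the CELL to fail at `j+1` (`not_cell_succ_of_bandTop_lt`: the remainder is `< e`). Both cases occur:
`(e,P) = (5,2)`: `j₀ = J = 2`; `(e,P) = (85,15)`: `j₀ = 5`, `J = 6` (`boundary_examples`). So a table column computed from the closed form is
exact up to `+1` at each place, and the exact `J` needs either the remainder `ρ_J` or one more cell evaluation. -/

namespace Summit.ABC.IUTFork.Repair.RH.TameBandLicence

/-- **Failure of the band-top inequality at `j` kills the CELL at `j+1`**: `j(e−1) < (j²−1)P` (`e, j ≥ 1`) ⟹ `¬ Cell e P (j+1)`. (Then `j ≥ 2`,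
`P ≥ 1`, `(2j+1)P > 2(e−1)`, so `((j+1)²−1)P ≥ (j+2)(e−1) + 2 > (j+1)(e−1) + ρ_{j+1}` since `ρ_{j+1} ≤ e−1`.) [folklore] -/
theorem not_cell_succ_of_bandTop_lt {e P j : ℤ} (he : 1 ≤ e) (hj : 1 ≤ j) (h : j * (e - 1) < (j ^ 2 - 1) * P) :
    ¬ Cell e P (j + 1) := by
  intro hc
  rw [cell_iff] at hc
  have hρ : ((j + 1) ^ 2 * P - 1) % e < e := Int.emod_lt_of_pos _ (by omega)
  have hP : 1 ≤ P := by
    by_contra hP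
    push Not at hP
    have h1 : (j ^ 2 - 1) * P ≤ 0 := mul_nonpos_of_nonneg_of_nonpos (by nlinarith) (by omega)
    nlinarith
  have hj2 : 2 ≤ j := by
    by_contra hlt
    have h1 : j = 1 := by omega
    subst h1
    nlinarith
  have key : 2 * (e - 1) < (2 * j + 1) * P := by
    by_contra hk
    push Not at hk
    have h1 : j * ((2 * j + 1) * P) ≤ j * (2 * (e - 1)) := mul_le_mul_of_nonneg_left hk (by omega)
    nlinarith
  have h2 : ((j + 1) ^ 2 - 1) * P = (j ^ 2 - 1) * P + (2 * j + 1) * P := by ring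
  nlinarith

/-- **The band-top labels are IN**: at a boundary pair `(J, J+1)`, every `j ≥ 1` with `(j²−1)P ≤ j(e−1)` satisfies `j ≤ J` — the lead's closed-form
`j₀` is a MINORANT of the exact boundary. [folklore] -/
theorem le_boundary_of_bandTop {e P J j : ℤ} (he : 1 ≤ e) (hJ : 1 ≤ J) (hin : Cell e P J) (hoff : ¬ Cell e P (J + 1))
    (hj : 1 ≤ j) (h : (j ^ 2 - 1) * P ≤ j * (e - 1)) : j ≤ J :=
  (cell_iff_le_of_boundary he hJ hin hoff hj).1 (cell_of_bandTop (by omega) h)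

/-- **…and the boundary exceeds them by at most one**: if the band-top inequality FAILS at `j ≥ 1` then `J ≤ j`. [folklore] -/
theorem boundary_le_of_bandTop_lt {e P J j : ℤ} (he : 1 ≤ e) (hin : Cell e P J) (hj : 1 ≤ j) (h : j * (e - 1) < (j ^ 2 - 1) * P) :
    J ≤ j := by
  by_contra hlt
  push Not at hlt
  exact not_cell_succ_of_bandTop_lt he hj h (cell_anti he (by omega) (show j + 1 ≤ J by omega) hin)

/-- **`J ∈ {j₀, j₀+1}`**: if `j₀ ≥ 1` is the LAST band-top label (`(j₀²−1)P ≤ j₀(e−1)` and `(j₀+1)(e−1) < ((j₀+1)²−1)P`) and `(J, J+1)` is a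
boundary pair, then `J = j₀` or `J = j₀ + 1`. [folklore] -/
theorem boundary_eq_or_eq_succ_of_bandTop {e P J j0 : ℤ} (he : 1 ≤ e) (hJ : 1 ≤ J) (hin : Cell e P J) (hoff : ¬ Cell e P (J + 1))
    (hj0 : 1 ≤ j0) (hbt : (j0 ^ 2 - 1) * P ≤ j0 * (e - 1)) (hbt' : (j0 + 1) * (e - 1) < ((j0 + 1) ^ 2 - 1) * P) :
    J = j0 ∨ J = j0 + 1 := by
  have h1 : j0 ≤ J := le_boundary_of_bandTop he hJ hin hoff hj0 hbt
  have h2 : J ≤ j0 + 1 := boundary_le_of_bandTop_lt he hin (by omega) hbt'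
  omega

/-- **Both cases occur.** `(e,P) = (5,2)`: band-top holds at `2`, fails at `3`, and the boundary is `J = 2 = j₀`. `(e,P) = (85,15)`: band-top holds
at `5`, fails at `6`, yet the cell still holds at `6` and fails at `7`, so `J = 6 = j₀ + 1` (cf. `window_rows`). [folklore] -/
theorem boundary_examples :
    (((2 : ℤ) ^ 2 - 1) * 2 ≤ 2 * (5 - 1) ∧ (3 : ℤ) * (5 - 1) < (3 ^ 2 - 1) * 2 ∧ Cell 5 2 2 ∧ ¬ Cell 5 2 3) ∧
    (((5 : ℤ) ^ 2 - 1) * 15 ≤ 5 * (85 - 1) ∧ (6 : ℤ) * (85 - 1) < (6 ^ 2 - 1) * 15 ∧ Cell 85 15 6 ∧ ¬ Cell 85 15 7) := by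
  simp only [Cell]
  decide

/-! ### The top-label mass quantum (MIN-SLICE (iv) «no interior solution», place level) -/

/-- One more label adds `6((n+1)²−1)` to the `j²−1` mass `n(n−1)(2n+5) = 6·Σ_{j≤n}(j²−1)`. [folklore] -/
theorem sliceMass_succ_sub (n : ℤ) :
    (n + 1) * (n + 1 - 1) * (2 * (n + 1) + 5) - n * (n - 1) * (2 * n + 5) = 6 * ((n + 1) ^ 2 - 1) := by
  ring

/-- **Dropping even ONE label (the top one) of a place costs `6(L²−1)` of its mass `L(L−1)(2L+5)`**: for `0 ≤ J ≤ L−1`,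
`J(J−1)(2J+5) + 6(L²−1) ≤ L(L−1)(2L+5)`. With `L = l⋆` the lost FRACTION is `6(l⋆+1)/(l⋆(2l⋆+5)) ≈ 3/l⋆ = 6/l` of the place's trivial cost —
against MIN-SLICE (ii)'s tolerance `1 − θ ≈ 1.4·10⁻¹⁴·d_mod` this is the place-level form of «mass(Σ)/M ≥ θ ⟺ Σ ∩ place = every label».
[folklore] -/
theorem sliceMass_add_quantum_le {J L : ℤ} (hJ : 0 ≤ J) (hJL : J ≤ L - 1) :
    J * (J - 1) * (2 * J + 5) + 6 * (L ^ 2 - 1) ≤ L * (L - 1) * (2 * L + 5) := by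
  have h1 : J * (J - 1) * (2 * J + 5) ≤ (L - 1) * (L - 1 - 1) * (2 * (L - 1) + 5) := sliceMass_mono hJ hJL
  have h2 : (L - 1 + 1) * (L - 1 + 1 - 1) * (2 * (L - 1 + 1) + 5) - (L - 1) * (L - 1 - 1) * (2 * (L - 1) + 5) =
      6 * ((L - 1 + 1) ^ 2 - 1) := sliceMass_succ_sub (L - 1)
  have h3 : (L - 1 + 1 : ℤ) = L := by ring
  rw [h3] at h2
  linarith

end Summit.ABC.IUTFork.Repair.RH.TameBandLicence
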